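import Mathlib
import Summits.MatrixMultiplication.MatrixMultiplication.Theses.FourierTwoFamiliesModP
import Summits.MatrixMultiplication.MatrixMultiplication.Theorems.PrimeLogDecay.Negative.LoadBearing
import Literature.Computability.AlgebraicComplexity.SimultaneousDoubleProduct

/-!
# The kill ladder at `PrimeLogDecay` (route `FourierTwoFamiliesModP`, item stmt-MatrixMultiplication-14310)

Support item `PrimeLogDecay` (log-power density decay `n·s·(log s)^c ≤ p` for balanced SDPP
families in `ℤ/pℤ`, `s ≥ s₀`) is the middle rung of the route's kill ladder
`PrimeCyclicPowerGain → PrimeLogDecay → PrimeDensityDecay`.  The lower rung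
`PrimeLogDecay → PrimeDensityDecay` is landed in
`Theorems/FourierTwoFamiliesModPPrimeDensityDecayLadder.lean`; this file lands the upper rung and
the item's trivial normalisations as kernel-checked glue, so that the item closes by one line as
soon as the sibling `PrimeCyclicPowerGain` (stmt-14309) closes, and so that an analytic proof may
target the cleanest form:

* `primeLogDecay_of_primeCyclicPowerGain : PrimeCyclicPowerGain → PrimeLogDecay`
  (`(log s)^c ≤ s^c`, so `n·s·(log s)^c ≤ n·s^{1+c} ≤ p`, same `c`, same `s₀`);
* `primeLogDecayWith_mono` : the explicit-constant form `PrimeLogDecayWith c s₀`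
  (`Theorems/PrimeLogDecay/Negative/LoadBearing.lean`) is monotone: it weakens as `c` decreases and
  `s₀` increases (for `s₀ ≥ 3`, where `log s ≥ 1`);
* `primeLogDecay_iff_le_one` : hence one may assume `0 < c ≤ 1`;
* `primeLogDecayWith_of_beyondWall` / `primeLogDecay_iff_beyondWall` : for `0 < c ≤ 1` the bound
  is automatic below the wall (`n·s² ≤ p` gives `n·s·(log s)^c ≤ n·s·s ≤ p`), so the item is
  EQUIVALENT to its restriction to configurations beyond the wall `p < n·s²` — the regime where the
  route's `CommonFrequencyBias` (stmt-14317, proved) supplies a biased frequency;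
* `primeLogDecay_iff_isSDPP` : the item restated with the Literature predicate
  `Literature.Computability.AlgebraicComplexity.IsSDPP` (clauses (W) ∧ (X)).

No new definitions; hypotheses (W), (X) are inlined verbatim as in the route file.  Nothing here
bears on the open regime `p < n·s²`, `s → ∞` of the item itself.
-/

-- the doubled path component `MatrixMultiplication.MatrixMultiplication` is the tree's layout (summit = problem)
set_option linter.dupNamespace false

namespace Summit.MatrixMultiplication.MatrixMultiplication.Theorems.PrimeLogDecay.Ladder

open Summit.MatrixMultiplication.MatrixMultiplication.Theses.FourierTwoFamiliesModP
open Summit.MatrixMultiplication.MatrixMultiplication.Theorems.PrimeLogDecay.Negative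
  (PrimeLogDecayWith primeLogDecay_iff)
open Literature.Computability.AlgebraicComplexity (IsSDPP)

/-- `(log s)^c ≤ s^c` for a natural number `s` and a real exponent `c ≥ 0`
(`0 ≤ log s ≤ s` for naturals, and `rpow` is monotone in a non-negative base). -/
theorem log_rpow_le_rpow (s : ℕ) {c : ℝ} (hc : 0 ≤ c) :
    Real.log (s : ℝ) ^ c ≤ (s : ℝ) ^ c :=
  Real.rpow_le_rpow (Real.log_natCast_nonneg s) (Real.log_le_self (Nat.cast_nonneg _)) hc

/-- **Rung 1 (upper).** A fixed power saving implies a log-power saving: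
`PrimeCyclicPowerGain → PrimeLogDecay`, with the same constants `c, s₀`:
`n·s·(log s)^c ≤ n·s·s^c = n·s^{1+c} ≤ p`. -/
theorem primeLogDecay_of_primeCyclicPowerGain (h : PrimeCyclicPowerGain) : PrimeLogDecay := by
  obtain ⟨c, hc, s₀, hs₀⟩ := h
  refine ⟨c, hc, s₀, ?_⟩
  intro p hp n s A B hs hcard hW hX
  have hmain := hs₀ p hp n s A B hs hcard hW hX
  have hs_nn : (0 : ℝ) ≤ (s : ℝ) := Nat.cast_nonneg _
  have hsplit : (s : ℝ) * (s : ℝ) ^ c = (s : ℝ) ^ (1 + c) := by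
    rcases eq_or_lt_of_le hs_nn with h0 | hpos
    · rw [← h0, Real.zero_rpow (by linarith : (1 + c) ≠ 0), zero_mul]
    · rw [Real.rpow_add hpos, Real.rpow_one]
  calc (n : ℝ) * (s : ℝ) * Real.log (s : ℝ) ^ c
      ≤ (n : ℝ) * (s : ℝ) * (s : ℝ) ^ c :=
        mul_le_mul_of_nonneg_left (log_rpow_le_rpow s hc.le) (by positivity)
    _ = (n : ℝ) * (s : ℝ) ^ (1 + c) := by rw [mul_assoc, hsplit]
    _ ≤ (p : ℝ) := hmain

/-- **Rung 1, registered form** (stub `stub_logDecayFromPowerGain` of item stmt-14310, signature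
verbatim): `PrimeCyclicPowerGain → PrimeLogDecay`. -/
theorem stub_logDecayFromPowerGain : Summit.MatrixMultiplication.MatrixMultiplication.Theses.FourierTwoFamiliesModP.PrimeCyclicPowerGain → Summit.MatrixMultiplication.MatrixMultiplication.Theses.FourierTwoFamiliesModP.PrimeLogDecay :=
  primeLogDecay_of_primeCyclicPowerGain

/-- **Monotonicity of the explicit-constant form.** If `n·s·(log s)^c ≤ p` holds for all balanced
SDPP configurations with `s ≥ s₀`, then `n·s·(log s)^{c'} ≤ p` holds for all those with
`s ≥ s₀' ≥ max s₀ 3`, for every `0 ≤ c' ≤ c` (as `log s ≥ 1` once `s ≥ 3`). -/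
theorem primeLogDecayWith_mono {c c' : ℝ} {s₀ s₀' : ℕ} (h : PrimeLogDecayWith c s₀)
    (hcc' : c' ≤ c) (hs : s₀ ≤ s₀') (h3 : 3 ≤ s₀') : PrimeLogDecayWith c' s₀' := by
  intro p hp n s A B hs' hcard hW hX
  have hmain := h p hp n s A B (le_trans hs hs') hcard hW hX
  have hlog : 1 ≤ Real.log (s : ℝ) := by
    have h3' : (3 : ℝ) ≤ (s : ℝ) := by exact_mod_cast le_trans h3 hs'
    exact (Literature.NumberTheory.Sieve.GreenTao2008.one_lt_log_of_three_le h3').le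
  have hpow : Real.log (s : ℝ) ^ c' ≤ Real.log (s : ℝ) ^ c :=
    Real.rpow_le_rpow_of_exponent_le hlog hcc'
  calc (n : ℝ) * (s : ℝ) * Real.log (s : ℝ) ^ c'
      ≤ (n : ℝ) * (s : ℝ) * Real.log (s : ℝ) ^ c :=
        mul_le_mul_of_nonneg_left hpow (by positivity)
    _ ≤ (p : ℝ) := hmain

/-- **WLOG `c ≤ 1`.** `PrimeLogDecay` is equivalent to its instance with an exponent `0 < c ≤ 1`
(shrink `c` to `min c 1` and raise `s₀` to `max s₀ 3`). -/
theorem primeLogDecay_iff_le_one :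
    PrimeLogDecay ↔ ∃ c : ℝ, 0 < c ∧ c ≤ 1 ∧ ∃ s₀ : ℕ, PrimeLogDecayWith c s₀ := by
  constructor
  · rintro ⟨c, hc, s₀, h⟩
    exact ⟨min c 1, lt_min hc one_pos, min_le_right _ _, max s₀ 3,
      primeLogDecayWith_mono h (min_le_left _ _) (le_max_left _ _) (le_max_right _ _)⟩
  · rintro ⟨c, hc, -, s₀, h⟩
    exact ⟨c, hc, s₀, h⟩

/-- **Below the wall the bound is free.** For `0 ≤ c ≤ 1`, if `n·s·(log s)^c ≤ p` holds for all
balanced SDPP configurations with `s ≥ s₀` BEYOND the wall (`p < n·s²`), then it holds for all of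
them: below the wall `n·s·(log s)^c ≤ n·s·s^c ≤ n·s·s = n·s² ≤ p`. -/
theorem primeLogDecayWith_of_beyondWall {c : ℝ} (hc : 0 ≤ c) (hc1 : c ≤ 1) {s₀ : ℕ}
    (h : ∀ p : ℕ, p.Prime → ∀ (n s : ℕ) (A B : Fin n → Finset (ZMod p)), s₀ ≤ s → p < n * s ^ 2 →
      (∀ i : Fin n, (A i).card = s ∧ (B i).card = s) →
      (∀ i : Fin n, ∀ a ∈ A i, ∀ a' ∈ A i, ∀ b ∈ B i, ∀ b' ∈ B i,
        (a - a') + (b - b') = 0 → a = a' ∧ b = b') →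
      (∀ i j k : Fin n, ∀ a ∈ A i, ∀ a' ∈ A j, ∀ b ∈ B j, ∀ b' ∈ B k,
        (a - a') + (b - b') = 0 → i = k) →
      (n : ℝ) * (s : ℝ) * Real.log (s : ℝ) ^ c ≤ (p : ℝ)) :
    PrimeLogDecayWith c s₀ := by
  intro p hp n s A B hs hcard hW hX
  by_cases hwall : p < n * s ^ 2
  · exact h p hp n s A B hs hwall hcard hW hX
  · push Not at hwall
    have hwall' : (n : ℝ) * (s : ℝ) ^ 2 ≤ (p : ℝ) := by exact_mod_cast hwall
    rcases Nat.eq_zero_or_pos s with hs0 | hspos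
    · subst hs0
      simp only [Nat.cast_zero, mul_zero, zero_mul]
      exact Nat.cast_nonneg _
    · have hs1 : (1 : ℝ) ≤ (s : ℝ) := by exact_mod_cast hspos
      have h1 : Real.log (s : ℝ) ^ c ≤ (s : ℝ) :=
        calc Real.log (s : ℝ) ^ c ≤ (s : ℝ) ^ c := log_rpow_le_rpow s hc
          _ ≤ (s : ℝ) ^ (1 : ℝ) := Real.rpow_le_rpow_of_exponent_le hs1 hc1
          _ = (s : ℝ) := Real.rpow_one _
      calc (n : ℝ) * (s : ℝ) * Real.log (s : ℝ) ^ c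
          ≤ (n : ℝ) * (s : ℝ) * (s : ℝ) := mul_le_mul_of_nonneg_left h1 (by positivity)
        _ = (n : ℝ) * (s : ℝ) ^ 2 := by ring
        _ ≤ (p : ℝ) := hwall'

/-- **The item is its beyond-the-wall instance.** `PrimeLogDecay` holds iff for some `0 < c ≤ 1`
and `s₀` every balanced SDPP configuration in `ℤ/pℤ` with `s ≥ s₀` and `p < n·s²` satisfies
`n·s·(log s)^c ≤ p` (the regime of `CommonFrequencyBias`). -/
theorem primeLogDecay_iff_beyondWall :
    PrimeLogDecay ↔ ∃ c : ℝ, 0 < c ∧ c ≤ 1 ∧ ∃ s₀ : ℕ,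
      ∀ p : ℕ, p.Prime → ∀ (n s : ℕ) (A B : Fin n → Finset (ZMod p)), s₀ ≤ s → p < n * s ^ 2 →
      (∀ i : Fin n, (A i).card = s ∧ (B i).card = s) →
      (∀ i : Fin n, ∀ a ∈ A i, ∀ a' ∈ A i, ∀ b ∈ B i, ∀ b' ∈ B i,
        (a - a') + (b - b') = 0 → a = a' ∧ b = b') →
      (∀ i j k : Fin n, ∀ a ∈ A i, ∀ a' ∈ A j, ∀ b ∈ B j, ∀ b' ∈ B k,
        (a - a') + (b - b') = 0 → i = k) →
      (n : ℝ) * (s : ℝ) * Real.log (s : ℝ) ^ c ≤ (p : ℝ) := by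
  rw [primeLogDecay_iff_le_one]
  constructor
  · rintro ⟨c, hc, hc1, s₀, h⟩
    exact ⟨c, hc, hc1, s₀, fun p hp n s A B hs _ hcard hW hX => h p hp n s A B hs hcard hW hX⟩
  · rintro ⟨c, hc, hc1, s₀, h⟩
    exact ⟨c, hc, hc1, s₀, primeLogDecayWith_of_beyondWall hc.le hc1 h⟩

/-- **The item in Literature vocabulary.** `PrimeLogDecay` restated with
`Literature.Computability.AlgebraicComplexity.IsSDPP A B` ((W) ∧ (X), CKSU 2005 Def. 4.1) in
place of the two inlined clauses. -/
theorem primeLogDecay_iff_isSDPP :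
    PrimeLogDecay ↔ ∃ c : ℝ, 0 < c ∧ ∃ s₀ : ℕ,
      ∀ p : ℕ, p.Prime → ∀ (n s : ℕ) (A B : Fin n → Finset (ZMod p)), IsSDPP A B → s₀ ≤ s →
      (∀ i : Fin n, (A i).card = s ∧ (B i).card = s) →
      (n : ℝ) * (s : ℝ) * Real.log (s : ℝ) ^ c ≤ (p : ℝ) := by
  constructor
  · rintro ⟨c, hc, s₀, h⟩
    exact ⟨c, hc, s₀, fun p hp n s A B hSD hs hcard => h p hp n s A B hs hcard hSD.1 hSD.2⟩
  · rintro ⟨c, hc, s₀, h⟩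
    exact ⟨c, hc, s₀, fun p hp n s A B hs hcard hW hX => h p hp n s A B ⟨hW, hX⟩ hs hcard⟩

end Summit.MatrixMultiplication.MatrixMultiplication.Theorems.PrimeLogDecay.Ladder
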